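import Literature.Probability.Percolation.FourArmGarbanConditional
import Literature.Probability.Percolation.FourArmGarbanSquareDomain
import Literature.Probability.Percolation.FourArmGarbanInterfaceEvents
import HarnessLib

/-!
# Garban's multi-scale four-arm bound modulo Kesten's arm separation (the concrete reduction)

Topic `Literature/Probability/Percolation`; support file for the named fact
`Garban2011_fourArm_multiscale` (`FourArmGarban.lean`; C. Garban, Appendix B of O. Schramm,
S. Smirnov, Ann. Probab. 39 (2011), Lemma B.1; J. van den Berg, P. Nolin, Progr. Probab. 77
(2020), Lemma 8). Bond percolation on `ℤ²`, `p = 1/2`.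

This file instantiates the construction data of Garban's proof (`GarbanExplorationData`,
`FourArmGarbanConditional.lean`) CONCRETELY — the admissible square `Q = {0, …, 4n}²` with
`∂₀Q` (the left side) wired (`squareDobrushin (4n)`, `FourArmGarbanSquareDomain.lean`), the grid
`squareCentres ρ n` of centres of the mesoscopic squares `Q_j = c_j + B(ρ)` in the middle part
`[n+2, 3n-2]²` of `Q`, the crossing variable `crossingSign n hn = 2·1_{γ reaches ∂₂Q} - 1` ("`Q` is crossed"),
the two-arm radius `b = n` — leaving the size `ρ = ρ(m)` of the squares and the radii
`a'(m) ≤ b'(m)` of the circuit annuli `S_j` as free parameters (Garban: "`δ` will be chosen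
later … if `δ` is chosen small enough"), and proves

  `Garban2011_fourArm_multiscale_of_separation`:
  **Garban's Lemma B.1 (the named fact `Garban2011_fourArm_multiscale`) follows from the single
  estimate `P_{1/2}(fourArmTwoClusters m n) ≤ K₂ · E[X C_j Y_j]` (all `j`, all scales
  `n ≥ C₀ m`)** — Garban's (B.2) `P⁴(r,R) ≍ P[Q_j pivotal for X]` with (B.4)
  `E[X C_j] ≳ P[Q_j pivotal for X]` and (B.7) `E[X C_j] = E[X C_j Y_j]`, i.e. the input from
  Kesten's arm-separation theory ("arm separation properties similar to ones used in
  [Smirnov–Werner 2001]"), which the tree does not have for bond percolation on `ℤ²`.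

The variant `Garban2011_fourArm_multiscale_of_separation'` takes the hypothesis without the
revealment indicator, `P_{1/2}(fourArmTwoClusters m n) ≤ K₂ · E[X C_j]` — Garban's (B.2)+(B.4)
alone — thanks to the proved (B.7) `E[X C_j] = E[X C_j Y_j]`
(`setIntegral_reveals_crossingSign_mul_circuitBit`, from `FourArmGarbanInterfaceEvents.lean`).

Everything else in Appendix B is thereby formalised: the circuit bits and `E[C_j] = 0`
(`FourArmGarbanCircuitBits.lean`), the interface and its two-arm revealment (B.6)
(`FourArmGarbanRevealment.lean`, `FourArmGarbanTwoArms.lean`), "nondiagonal terms vanish"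
(`FourArmGarbanOrthogonality.lean`), the Cauchy–Schwarz step (B.8)
(`OrthogonalRevealmentBound.lean`) and the final count (`FourArmGarbanAssembly.lean`).
No named fact is introduced.

## References

* O. Schramm, S. Smirnov (appendix by C. Garban), Ann. Probab. 39 (2011), Appendix B, Lemma B.1
  and its proof, (B.2)–(B.8) [SchrammSmirnov2011].
* J. van den Berg, P. Nolin, Progr. Probab. 77 (2020), §4.3 Lemma 8, §5.1 [VandenbergNolin2020].
* H. Kesten, Comm. Math. Phys. 109 (1987) (arm separation) [KestenScalingCMP1987].
-/

noncomputable section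

namespace Literature.Probability.Percolation

open _root_.MeasureTheory Set LatticeModels LatticeModels.DiscreteDobrushin

/-! ### The concrete construction at the scales `(m, n)` -/

/-- The number of mesoscopic squares along one direction: `⌊(2n-4)/(2ρ+1)⌋ + 1` squares of
half-side `ρ` with centres `2ρ+1` apart fit in `[n+2, 3n-2]`. [folklore] -/
def squareGridCount (ρ n : ℕ) : ℕ := (2 * n - 4) / (2 * ρ + 1) + 1

/-- The centre of the mesoscopic square with grid index `k`:
`(n + 2 + (2ρ+1) k₀, n + 2 + (2ρ+1) k₁)`. [cite: SchrammSmirnov2011, Appendix B, proof of Lemma B.1 (the squares Q_j)] -/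
def squareCentre (ρ n : ℕ) (k : Fin (squareGridCount ρ n) × Fin (squareGridCount ρ n)) : Site 2 :=
  pt ((n : ℤ) + 2 + (2 * ρ + 1) * (k.1 : ℕ)) ((n : ℤ) + 2 + (2 * ρ + 1) * (k.2 : ℕ))

/-- **The centres `c_j` of the mesoscopic squares** `Q_j = c_j + B(ρ)` inside Garban's square
`{0, …, 4n}²` ("cut the concentric `Q/3` square into `r × r` squares `Q_j`"; here the squares
fill `[n+2-ρ, 3n-2+ρ]²`). [cite: SchrammSmirnov2011, Appendix B, proof of Lemma B.1 (the squares Q_j)] -/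
def squareCentres (ρ n : ℕ) : Finset (Site 2) :=
  Finset.univ.image (squareCentre ρ n)

/-- The pairs of sites touching the right side `∂₂Q = {x₀ = 4n}` of Garban's square. [folklore] -/
def rightColumnPairs (n : ℕ) : Set (Sym2 (Site 2)) :=
  {e | ∃ x ∈ e, x 0 = ((4 * n : ℕ) : ℤ)}

/-- Garban's square `{0, …, 4n}²` is admissible for `n ≥ 1`. [folklore] -/
theorem isZdAdmissible_square (n : ℕ) (hn : 1 ≤ n) : (squareDobrushin (4 * n)).IsZdAdmissible :=
  isZdAdmissible_squareDobrushin (by omega)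

/-- **Garban's crossing variable** `X = 2·1_{Q crossed} - 1` ("the crossing random variable equal
to `1` when `Q` is crossed and `-1` otherwise"), with "`Q` is crossed from the wired side `∂₀Q` to
the opposite side `∂₂Q`" rendered through the interface: the medial exploration `γ` of
`squareDobrushin (4n)` (running between the two ends of `∂₀Q`, the open cluster of `∂₀Q` on its
left) arrives at an edge touching the right side `{x₀ = 4n}` — i.e. the open cluster of the wired
side reaches the sites adjacent to `∂₂Q`. This makes `X` a function of the interface, as Garban's
(B.7) `E[X C_j] = E[X C_j Y_j]` uses. [cite: SchrammSmirnov2011, Appendix B, proof of Lemma B.1 (the crossing random variable X)] -/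
def crossingSign (n : ℕ) (hn : 1 ≤ n) (ω : BondConfig (Site 2)) : ℝ :=
  2 * (Reveals (isZdAdmissible_square n hn) (rightColumnPairs n)).indicator
    (1 : BondConfig (Site 2) → ℝ) ω - 1

/-! ### Elementary properties of the construction -/

/-- `X` is measurable. [folklore] -/
theorem measurable_crossingSign (n : ℕ) (hn : 1 ≤ n) : Measurable (crossingSign n hn) :=
  ((measurable_const.mul (measurable_one.indicator (measurableSet_reveals _ _))).sub
    measurable_const)

/-- `|X| ≤ 1` (`X = ±1`). [folklore] -/
theorem abs_crossingSign_le (n : ℕ) (hn : 1 ≤ n) (ω : BondConfig (Site 2)) :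
    |crossingSign n hn ω| ≤ 1 := by
  unfold crossingSign
  by_cases h : ω ∈ Reveals (isZdAdmissible_square n hn) (rightColumnPairs n) <;> norm_num [h]

/-- The centre map is injective (the spacing `2ρ+1` is positive). [folklore] -/
theorem squareCentre_injective (ρ n : ℕ) : Function.Injective (squareCentre ρ n) := by
  intro k k' h
  have h0 := congrFun h 0
  have h1 := congrFun h 1
  simp only [squareCentre, pt_apply_zero, pt_apply_one] at h0 h1
  have hpos : (0 : ℤ) < 2 * ρ + 1 := by positivity
  have e0 : ((k.1 : ℕ) : ℤ) = (k'.1 : ℕ) := by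
    have := mul_left_cancel₀ hpos.ne' (by linarith : (2 * (ρ : ℤ) + 1) * (k.1 : ℕ) = (2 * ρ + 1) * (k'.1 : ℕ))
    exact this
  have e1 : ((k.2 : ℕ) : ℤ) = (k'.2 : ℕ) := by
    have := mul_left_cancel₀ hpos.ne' (by linarith : (2 * (ρ : ℤ) + 1) * (k.2 : ℕ) = (2 * ρ + 1) * (k'.2 : ℕ))
    exact this
  exact Prod.ext (Fin.ext (by exact_mod_cast e0)) (Fin.ext (by exact_mod_cast e1))

/-- There are `N²` squares, `N = squareGridCount ρ n`. [folklore] -/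
theorem card_squareCentres (ρ n : ℕ) : (squareCentres ρ n).card = squareGridCount ρ n ^ 2 := by
  rw [squareCentres, Finset.card_image_of_injective _ (squareCentre_injective ρ n), Finset.card_univ,
    Fintype.card_prod, Fintype.card_fin, sq]

/-- Grid indices times the spacing stay within `2n - 4`. [folklore] -/
theorem spacing_mul_lt_le (ρ n : ℕ) (k : Fin (squareGridCount ρ n)) : (2 * ρ + 1) * (k : ℕ) ≤ 2 * n - 4 := by
  have hk : (k : ℕ) ≤ (2 * n - 4) / (2 * ρ + 1) := Nat.le_of_lt_succ k.isLt
  calc (2 * ρ + 1) * (k : ℕ) ≤ (2 * ρ + 1) * ((2 * n - 4) / (2 * ρ + 1)) := Nat.mul_le_mul_left _ hk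
    _ ≤ 2 * n - 4 := Nat.mul_div_le _ _

/-- **Coordinates of the centres lie in `[n+2, 3n-2]`.** [folklore] -/
theorem squareCentres_coord_bounds {ρ n : ℕ} (hn : 2 ≤ n) {c : Site 2} (hc : c ∈ squareCentres ρ n) :
    ∀ i : Fin 2, (n : ℤ) + 2 ≤ c i ∧ c i ≤ 3 * (n : ℤ) - 2 := by
  rw [squareCentres, Finset.mem_image] at hc
  obtain ⟨k, -, rfl⟩ := hc
  have h1 : (2 * (ρ : ℤ) + 1) * (k.1 : ℕ) ≤ 2 * n - 4 := by
    have := spacing_mul_lt_le ρ n k.1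
    zify [show 4 ≤ 2 * n by omega] at this
    exact this
  have h2 : (2 * (ρ : ℤ) + 1) * (k.2 : ℕ) ≤ 2 * n - 4 := by
    have := spacing_mul_lt_le ρ n k.2
    zify [show 4 ≤ 2 * n by omega] at this
    exact this
  have h1' : (0 : ℤ) ≤ (2 * ρ + 1) * (k.1 : ℕ) := by positivity
  have h2' : (0 : ℤ) ≤ (2 * ρ + 1) * (k.2 : ℕ) := by positivity
  rw [Fin.forall_fin_two]
  simp only [squareCentre, pt_apply_zero, pt_apply_one]
  exact ⟨⟨by linarith, by linarith⟩, ⟨by linarith, by linarith⟩⟩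

/-- **The arcs are far from every square**: a site of the outer layer of `{0, …, 4n}²` is not
within `n + 1` of a centre. [folklore] -/
theorem layer_sub_notMem_box {ρ n : ℕ} (hn : 2 ≤ n) {c x : Site 2} (hc : c ∈ squareCentres ρ n)
    (hlayer : ∃ i, x i = 0 ∨ x i = ((4 * n : ℕ) : ℤ)) :
    x - c ∉ box 2 (n + 1) := by
  intro h
  obtain ⟨i, hi⟩ := hlayer
  have hb := (mem_box.1 h) i
  have hc' := squareCentres_coord_bounds hn hc i
  simp only [Pi.sub_apply] at hb
  push_cast at hb hi hc'
  rcases hi with hi | hi <;> omega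

/-- The wired arc is far from every square. [folklore] -/
theorem zdArcA_far {ρ n : ℕ} (hn : 2 ≤ n) {c : Site 2} (hc : c ∈ squareCentres ρ n) :
    ∀ x ∈ (squareDobrushin (4 * n)).zdArcA, x - c ∉ box 2 (n + 1) := by
  intro x hx
  rw [mem_zdArcA_squareDobrushin_iff (by omega)] at hx
  exact layer_sub_notMem_box hn hc ⟨0, Or.inl hx.2⟩

/-- The dual-wired arc is far from every square. [folklore] -/
theorem zdArcB_far {ρ n : ℕ} (hn : 2 ≤ n) {c : Site 2} (hc : c ∈ squareCentres ρ n) :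
    ∀ x ∈ (squareDobrushin (4 * n)).zdArcB, x - c ∉ box 2 (n + 1) := by
  intro x hx
  rw [mem_zdArcB_squareDobrushin_iff (by omega)] at hx
  exact layer_sub_notMem_box hn hc hx.1.2

/-- **The squares are pairwise disjoint**: distinct centres differ by a nonzero multiple of the
spacing `2ρ + 1` in some coordinate, so the boxes of radius `ρ` (hence their pair sets) are
disjoint. [folklore] -/
theorem squareCentres_separated (ρ n : ℕ) :
    ∀ c ∈ squareCentres ρ n, ∀ c' ∈ squareCentres ρ n, c ≠ c' →
      Disjoint (boxPairs c ρ) (boxPairs c' ρ) := by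
  intro c hc c' hc' hne
  rw [squareCentres, Finset.mem_image] at hc hc'
  obtain ⟨k, -, rfl⟩ := hc
  obtain ⟨k', -, rfl⟩ := hc'
  -- a coordinate where the centres differ by at least the spacing
  have hdiff : ∃ i : Fin 2, (2 * (ρ : ℤ) + 1) ≤ |squareCentre ρ n k i - squareCentre ρ n k' i| := by
    by_cases h1 : k.1 = k'.1
    · have h2 : k.2 ≠ k'.2 := fun h2 => hne (by rw [Prod.ext h1 h2])
      refine ⟨1, ?_⟩
      simp only [squareCentre, pt_apply_one]
      have hne2 : ((k.2 : ℕ) : ℤ) ≠ (k'.2 : ℕ) := fun h => h2 (Fin.ext (by exact_mod_cast h))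
      rw [show (n : ℤ) + 2 + (2 * ρ + 1) * (k.2 : ℕ) - ((n : ℤ) + 2 + (2 * ρ + 1) * (k'.2 : ℕ)) =
        (2 * ρ + 1) * (((k.2 : ℕ) : ℤ) - (k'.2 : ℕ)) by ring, abs_mul,
        abs_of_nonneg (by positivity : (0 : ℤ) ≤ 2 * ρ + 1)]
      have : (1 : ℤ) ≤ |((k.2 : ℕ) : ℤ) - (k'.2 : ℕ)| := by
        rcases lt_or_gt_of_ne hne2 with h | h
        · rw [abs_of_neg (by omega)]; omega
        · rw [abs_of_pos (by omega)]; omega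
      nlinarith
    · refine ⟨0, ?_⟩
      simp only [squareCentre, pt_apply_zero]
      have hne1 : ((k.1 : ℕ) : ℤ) ≠ (k'.1 : ℕ) := fun h => h1 (Fin.ext (by exact_mod_cast h))
      rw [show (n : ℤ) + 2 + (2 * ρ + 1) * (k.1 : ℕ) - ((n : ℤ) + 2 + (2 * ρ + 1) * (k'.1 : ℕ)) =
        (2 * ρ + 1) * (((k.1 : ℕ) : ℤ) - (k'.1 : ℕ)) by ring, abs_mul,
        abs_of_nonneg (by positivity : (0 : ℤ) ≤ 2 * ρ + 1)]
      have : (1 : ℤ) ≤ |((k.1 : ℕ) : ℤ) - (k'.1 : ℕ)| := by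
        rcases lt_or_gt_of_ne hne1 with h | h
        · rw [abs_of_neg (by omega)]; omega
        · rw [abs_of_pos (by omega)]; omega
      nlinarith
  obtain ⟨i, hi⟩ := hdiff
  rw [Set.disjoint_left]
  intro e he he'
  induction e using Sym2.ind with
  | h x y =>
    have hx := mem_boxPairs_iff.1 he x (Sym2.mem_mk_left _ _)
    have hx' := mem_boxPairs_iff.1 he' x (Sym2.mem_mk_left _ _)
    have b1 := (mem_box.1 hx) i
    have b2 := (mem_box.1 hx') i
    simp only [Pi.sub_apply] at b1 b2
    rcases le_abs.1 hi with h | h <;> omega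

/-- **Enough squares**: for `n ≥ 20 m`, `m ≥ 1` and `ρ ≤ 4m`, the grid has at least `n/(9m)`
squares along each direction, hence `card ≥ (n/m)²/81`. [folklore] -/
theorem card_squareCentres_ge {ρ m n : ℕ} (hm : 1 ≤ m) (hρ : ρ ≤ 4 * m) (hn : 20 * m ≤ n) :
    (1 / 81 : ℝ) * ((n : ℝ) / m) ^ 2 ≤ ((squareCentres ρ n).card : ℝ) := by
  rw [card_squareCentres]
  set N := squareGridCount ρ n with hN
  -- `N > (2n-4)/(2ρ+1)` as reals
  have hq : ((2 * n - 4 : ℕ) : ℝ) < N * (2 * ρ + 1 : ℕ) := by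
    -- `(2n-4) < ((2n-4)/(2ρ+1) + 1) * (2ρ+1)`
    have h2 : 2 * n - 4 < ((2 * n - 4) / (2 * ρ + 1) + 1) * (2 * ρ + 1) :=
      (Nat.div_lt_iff_lt_mul (by positivity)).1 (Nat.lt_succ_self _)
    have h3 : ((2 * n - 4 : ℕ) : ℝ) < ((((2 * n - 4) / (2 * ρ + 1) + 1) * (2 * ρ + 1) : ℕ) : ℝ) := by
      exact_mod_cast h2
    simpa [hN, squareGridCount] using h3
  have hm0 : (0 : ℝ) < m := by exact_mod_cast hm
  have hn4 : 4 ≤ n := by omega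
  have hsub : ((2 * n - 4 : ℕ) : ℝ) = 2 * n - 4 := by
    rw [Nat.cast_sub (by omega)]; push_cast; ring
  rw [hsub] at hq
  have hρr : ((2 * ρ + 1 : ℕ) : ℝ) ≤ 9 * m := by
    have : 2 * ρ + 1 ≤ 9 * m := by omega
    exact_mod_cast this
  have hnr : (20 : ℝ) * m ≤ n := by exact_mod_cast hn
  have hN0 : (0 : ℝ) ≤ N := by positivity
  -- `n ≤ 2n - 4 < N (2ρ+1) ≤ 9 m N`, so `n/m ≤ 9 N`
  have h5 : (N : ℝ) * ((2 * ρ + 1 : ℕ) : ℝ) ≤ N * (9 * m) := mul_le_mul_of_nonneg_left hρr hN0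
  have hn4r : (4 : ℝ) ≤ n := by exact_mod_cast hn4
  have key : (n : ℝ) ≤ 9 * m * N := by linarith
  have key' : (n : ℝ) / m ≤ 9 * N := by
    rw [div_le_iff₀ hm0]; linarith
  have hnm0 : 0 ≤ (n : ℝ) / m := by positivity
  calc (1 / 81 : ℝ) * ((n : ℝ) / m) ^ 2 ≤ (1 / 81) * (9 * N) ^ 2 := by gcongr
    _ = ((N ^ 2 : ℕ) : ℝ) := by push_cast; ring

/-! ### The data, and the fact modulo separation -/

/-- **Garban's construction data at the scales `(m, n)`, given the separation estimate.**
For `m ≥ 1`, `n ≥ 20 m`, squares of half-side `ρ ≤ 4m` (Garban: `r ≍` the inner scale) and circuit radii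
`a' ≤ b'`, `b' + 2 ≤ ρ`, and the estimate `sep` for these concrete objects, the structure
`GarbanExplorationData (1/81) K₂ 6 m n` (domain `squareDobrushin (4n)`, centres
`squareCentres ρ n`, `X = crossingSign n hn`, two-arm radius `n`). [cite: SchrammSmirnov2011, Appendix B, proof of Lemma B.1 (the construction)] -/
def squareExplorationData {m n ρ a' b' : ℕ} {K₂ : ℝ} (hm : 1 ≤ m) (hn : 20 * m ≤ n)
    (hρ : ρ ≤ 4 * m) (hab : a' ≤ b') (hb' : b' + 2 ≤ ρ)
    (sep : ∀ j ∈ squareCentres ρ n,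
      (bondPercolation (zdGraph 2) half).real (fourArmTwoClusters m n) ≤
        K₂ * ∫ ω in Reveals (isZdAdmissible_square n (by omega)) (boxPairs j ρ),
          crossingSign n (by omega) ω * circuitBit j a' b' ω ∂(bondPercolation (zdGraph 2) half)) :
    GarbanExplorationData (1 / 81) K₂ 6 m n where
  D := squareDobrushin (4 * n)
  hD := isZdAdmissible_square n (by omega)
  J := squareCentres ρ n
  X := crossingSign n (by omega)
  ρ := ρ
  a' := a'
  b' := b'
  b := n
  card_le := card_squareCentres_ge hm hρ hn
  measurable_X := measurable_crossingSign n _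
  abs_X_le := abs_crossingSign_le n _
  a'_le := hab
  b'_le := hb'
  ρ_le := by omega
  ratio_le := by
    have hn0 : (0 : ℝ) < n := by
      have h1 : (1 : ℝ) ≤ n := by exact_mod_cast (show 1 ≤ n by omega)
      linarith
    have h1 : ((ρ + 2 : ℕ) : ℝ) ≤ 6 * m := by exact_mod_cast (show ρ + 2 ≤ 6 * m by omega)
    exact div_le_div_of_nonneg_right h1 hn0.le
  separated := squareCentres_separated ρ n
  arcA_far := fun j hj => zdArcA_far (by omega) hj
  arcB_far := fun j hj => zdArcB_far (by omega) hj
  sep := sep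

/-- **Garban's multi-scale four-arm bound modulo Kesten's arm separation.** Fix the size
`ρ(m) ≤ 4m` of the mesoscopic squares (Garban: `r`, the inner scale) and the radii
`a'(m) ≤ b'(m) ≤ ρ(m) - 2`
of the circuit annuli (Garban's `δ`). If for some `K₂ ≥ 0` and `C₀ ≥ 20`, at all scales
`m ≥ 1`, `n ≥ C₀ m` and for every mesoscopic square `Q_j = c_j + B(ρ)` of the square
`Q = {0, …, 4n}²`,

  `P_{1/2}(fourArmTwoClusters m n) ≤ K₂ · ∫_{γ reveals Q_j} X · C_j dP_{1/2}`

(`X = crossingSign n hn`, `C_j = circuitBit c_j a' b'`, `γ` the medial exploration of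
`squareDobrushin (4n)`) — Garban's (B.2)+(B.4)+(B.7), the arm-separation input — then the
named fact `Garban2011_fourArm_multiscale` holds. [cite: SchrammSmirnov2011, Appendix B, Lemma B.1] -/
theorem Garban2011_fourArm_multiscale_of_separation (ρ a' b' : ℕ → ℕ)
    (hρ : ∀ m, 1 ≤ m → ρ m ≤ 4 * m) (hab : ∀ m, a' m ≤ b' m)
    (hb' : ∀ m, 1 ≤ m → b' m + 2 ≤ ρ m) {K₂ : ℝ} (hK₂ : 0 ≤ K₂) {C₀ : ℕ} (hC₀ : 20 ≤ C₀)
    (hsep : ∀ (m n : ℕ) (hm : 1 ≤ m) (hmn : C₀ * m ≤ n) (hn : 1 ≤ n), ∀ j ∈ squareCentres (ρ m) n,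
      (bondPercolation (zdGraph 2) half).real (fourArmTwoClusters m n) ≤
        K₂ * ∫ ω in Reveals (isZdAdmissible_square n hn) (boxPairs j (ρ m)),
          crossingSign n hn ω * circuitBit j (a' m) (b' m) ω ∂(bondPercolation (zdGraph 2) half)) :
    Garban2011_fourArm_multiscale := by
  refine Garban2011_fourArm_multiscale_of_explorationData (K₁ := 1 / 81) (K₂ := K₂) (K₄ := 6)
    (by norm_num) hK₂ (by norm_num) (C₀ := C₀) (by omega) fun m n hm hmn => ?_
  have hn : 20 * m ≤ n := le_trans (Nat.mul_le_mul_right _ hC₀) hmn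
  have hn1 : 1 ≤ n := by omega
  exact ⟨squareExplorationData hm hn (hρ m hm) (hab m) (hb' m hm) (hsep m n hm hmn hn1)⟩

/-! ### (B.7) for the concrete objects, and the fact from (B.2)+(B.4) alone -/

/-- **(B.7) `E[X C_j Y_j] = E[X C_j]` for Garban's square**: since `X = crossingSign n hn` is
read off the interface and `C_j = circuitBit c_j a' b'` lives inside `Q_j = c_j + B(ρ)`
(`b' + 2 ≤ ρ`) with `E[C_j] = 0`, restricting to the revealment event does not change the
correlation (`integral_sign_mul_bit_indicator_compl_reveals_eq_zero`).
[cite: SchrammSmirnov2011, Appendix B, proof of Lemma B.1, (B.7)] -/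
theorem setIntegral_reveals_crossingSign_mul_circuitBit {n ρ a' b' : ℕ} (hn : 1 ≤ n)
    (hb' : b' + 2 ≤ ρ) (j : Site 2) :
    ∫ ω in Reveals (isZdAdmissible_square n hn) (boxPairs j ρ),
        crossingSign n hn ω * circuitBit j a' b' ω ∂(bondPercolation (zdGraph 2) half) =
      ∫ ω, crossingSign n hn ω * circuitBit j a' b' ω ∂(bondPercolation (zdGraph 2) half) := by
  set P := bondPercolation (zdGraph 2) half with hP
  set hD := isZdAdmissible_square n hn
  set V := Reveals hD (boxPairs j ρ) with hV
  have hVm : MeasurableSet V := measurableSet_reveals hD _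
  set f : BondConfig (Site 2) → ℝ := fun ω => crossingSign n hn ω * circuitBit j a' b' ω with hf
  have hfm : Measurable f := (measurable_crossingSign n hn).mul (measurable_circuitBit j a' b')
  have hfb : ∀ ω, |f ω| ≤ 1 := fun ω => by
    rw [hf]; simp only [abs_mul]
    exact mul_le_one₀ (abs_crossingSign_le n hn ω) (abs_nonneg _) (abs_circuitBit_le_one j a' b' ω)
  have hfi : Integrable f P := Integrable.of_bound hfm.aestronglyMeasurable 1
    (ae_of_all _ fun ω => by rw [Real.norm_eq_abs]; exact hfb ω)
  have hfi' : Integrable (fun ω => f ω * Vᶜ.indicator (1 : BondConfig (Site 2) → ℝ) ω) P := by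
    refine Integrable.of_bound (hfm.mul (measurable_one.indicator hVm.compl)).aestronglyMeasurable 1
      (ae_of_all _ fun ω => ?_)
    rw [Real.norm_eq_abs, abs_mul]
    have : |Vᶜ.indicator (1 : BondConfig (Site 2) → ℝ) ω| ≤ 1 := by
      by_cases h : ω ∈ Vᶜ <;> simp [h]
    exact mul_le_one₀ (hfb ω) (abs_nonneg _) this
  have hsplit : ∀ ω, V.indicator f ω = f ω - f ω * Vᶜ.indicator (1 : BondConfig (Site 2) → ℝ) ω := by
    intro ω
    by_cases h : ω ∈ V
    · have : ω ∉ Vᶜ := fun h' => h' h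
      simp [h, this]
    · have : ω ∈ Vᶜ := h
      simp [h, this]
  have key : ∫ ω in V, f ω ∂P = ∫ ω, f ω ∂P - ∫ ω, f ω * Vᶜ.indicator (1 : BondConfig (Site 2) → ℝ) ω ∂P := by
    rw [← integral_sub hfi hfi', ← integral_indicator hVm]
    exact integral_congr_ae (ae_of_all _ fun ω => hsplit ω)
  have h0 : ∫ ω, f ω * Vᶜ.indicator (1 : BondConfig (Site 2) → ℝ) ω ∂P = 0 := by
    have hFj := circuitPairs_subset_boxPairs j (show b' + 1 ≤ ρ by omega)
    have := integral_sign_mul_bit_indicator_compl_reveals_eq_zero hD half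
      (isInterfaceEvent_reveals hD (rightColumnPairs n)) (E := boxPairs j ρ) (fun _ he _ => hFj he)
      ((determinedBy_openCircuitInAnnulusAt j a' b').mono subset_union_left)
      ((determinedBy_dualCircuitInAnnulusAt j a' b').mono subset_union_right)
      (measurableSet_openCircuitInAnnulusAt j a' b') (measurableSet_dualCircuitInAnnulusAt j a' b')
      (real_dualCircuitInAnnulusAt_half j a' b').symm
    simpa [hf, crossingSign, circuitBit, mul_assoc] using this
  show ∫ ω in V, f ω ∂P = ∫ ω, f ω ∂P
  rw [key, h0, sub_zero]

/-- **Garban's lemma from (B.2)+(B.4) alone** (with (B.7) now proved): if for every mesoscopic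
square `P_{1/2}(fourArmTwoClusters m n) ≤ K₂ · E[X C_j]` — Garban's (B.2)
`P⁴(r,R) ≍ P[Q_j pivotal for X]` combined with (B.4) `E[X C_j] ≳ P[Q_j pivotal for X]`, the
statements proved in the source "by arm separation properties" (Kesten 1987) — then the named
fact `Garban2011_fourArm_multiscale` holds. [cite: SchrammSmirnov2011, Appendix B, Lemma B.1, (B.2) and (B.4)] -/
theorem Garban2011_fourArm_multiscale_of_separation' (ρ a' b' : ℕ → ℕ)
    (hρ : ∀ m, 1 ≤ m → ρ m ≤ 4 * m) (hab : ∀ m, a' m ≤ b' m)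
    (hb' : ∀ m, 1 ≤ m → b' m + 2 ≤ ρ m) {K₂ : ℝ} (hK₂ : 0 ≤ K₂) {C₀ : ℕ} (hC₀ : 20 ≤ C₀)
    (hsep : ∀ (m n : ℕ) (hm : 1 ≤ m) (hmn : C₀ * m ≤ n) (hn : 1 ≤ n), ∀ j ∈ squareCentres (ρ m) n,
      (bondPercolation (zdGraph 2) half).real (fourArmTwoClusters m n) ≤
        K₂ * ∫ ω, crossingSign n hn ω * circuitBit j (a' m) (b' m) ω ∂(bondPercolation (zdGraph 2) half)) :
    Garban2011_fourArm_multiscale :=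
  Garban2011_fourArm_multiscale_of_separation ρ a' b' hρ hab hb' hK₂ hC₀
    fun m n hm hmn hn j hj => by
      rw [setIntegral_reveals_crossingSign_mul_circuitBit hn (hb' m hm) j]
      exact hsep m n hm hmn hn j hj

end Literature.Probability.Percolation
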